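import Literature.Probability.RandomPlanarGeometry.SAWLoopErasureGreenThreeEnclosures
import HarnessLib

/-!
# SRW on `ℤ³`: the Green function at the four sites with `|x|₁ = 4` — `G₃(4e₁)` certified by the class machinery,
# `G₃(3e₁+e₂)`, `G₃(2e₁+2e₂)`, `G₃(2e₁+e₂+e₃)` by harmonicity

Topic `Literature/Probability/RandomPlanarGeometry` (the Green-function data layer of the Hara–Slade–Sokal loop-erasure
programme in `d = 3`).  The `(2̃,1)` row of [HSS93, Table 2] consumes `G(x) = C₀(0,x;1/6) = Σₙ pₙ(x)` at the seven classes
`|x|₁ ≤ 3` (`SAWLoopErasureGreenThreeEnclosures.green_three_*`, width `≤ 6·10⁻¹⁰`).  The `(2̃,2)` row (two-site taboo sets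
`A = {e, e+f}`; HSS93 §2.4 (2.36)–(2.39), Table 2 p. 12: `μ(ℤ³) ≥ 4.552467`) consumes, through the singleton-taboo systems at the
second shell, the four further classes `|x|₁ = 4`: `4e₁, 3e₁+e₂, 2e₁+2e₂, 2e₁+e₂+e₃`.  This file supplies them:

* **§1 the class law at `4e₁`** — one more application of the tree's summation by parts in one coordinate
  (`GreenThree.srwLaw_parts`, here with last coordinates `2, 4, 3`): `(m+1)(p_m(2e₁) − p_m(4e₁)) = 18 p_{m+1}(3e₁)`, hence
  `p_{2n}(4e₁) = p_{2n}(2e₁) − 18 p_{2n+1}(3e₁)/(2n+1)`, i.e. with the tree's class laws for `2e₁, 3e₁`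
  `p_{2n}(4e₁) = qₙ − 24 q_{n+1}/(2n+1) + 108 q_{n+1}/((2n+1)(n+1)) − 648 q_{n+2}/((2n+1)(n+1)(2n+3))` (`q_k = p_{2k}(0)`);
* **§2 three more atoms** — the weighted origin tails `C₂₅₇ = Σ_{n>257} qₙ/n` (two-sided, potentials `θ±_inv` of
  `SAWLoopErasureGreenThreeTails`), `A₂₅₈ = Σ_{n>258} qₙ` (upper) and the ratio step `q₂₅₈ ≤ ρ(258) q₂₅₇`;
* **§3 the class tail at `4e₁`** as `A₂₅₆ + 192·B₂₅₇ − 108·C₂₅₇ − R` with the remainder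
  `R = Σ_{n ≥ 259} 648 qₙ/((2n−3)(n−1)(2n−1)) ∈ [0, w(259)·A₂₅₈]` (`w(259) = 108/11448965`; `R ≈ 4·10⁻⁸` is the only term not
  resolved into the four atoms of the tree — its kernel `1/(2n−3)` is not among `1, 1/n, 1/(n−1), 1/(2n−1)` — and it is simply
  enclosed by `0 ≤ w(n) ≤ w(259)`, which costs `2.7·10⁻⁷` of width and nothing else);
* **§4 the head** `Σ_{k<255} p_{2k+4}(4e₁) ∈ [9306163014649, 9306163014650]·10⁻¹⁴` decided in the kernel (`GreenNbhd.partialQAt`);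
* **§5 `green_three_4 : G₃(4e₁) ∈ [0.1217329686, 0.1217332440]`** (`linarith` on §2–§4 and the tree's enclosures of
  `q₂₅₅, q₂₅₆, q₂₅₇, A₂₅₆, B₂₅₇`);
* **§6 harmonicity** `6·G(x) = Σ_{|e|=1} G(x+e)` (`x ≠ 0`; the one-step recursion of `pₙ` summed over `n`, any `d`) and the
  lattice symmetries (`srwI_spAct`) at `x = 3e₁, 2e₁+e₂, e₁+e₂+e₃`, whence
  **`green_three_211 : G₃(2e₁+e₂+e₃) ∈ [0.1917916504, 0.1917916509]`** (`= 2G(e₁+e₂+e₃) − G(e₁+e₂)`),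
  **`green_three_31 : G₃(3e₁+e₂) ∈ [0.1531388882, 0.1531389581]`** (`= (6G(3e₁) − G(2e₁) − G(4e₁))/4`),
  **`green_three_22 : G₃(2e₁+2e₂) ∈ [0.1683309753, 0.1683310474]`** (`= 6G(2e₁+e₂) − G(e₁+e₂) − G(3e₁+e₂) − G(2e₁) − 2G(2e₁+e₂+e₃)`).

Floating point (modified-Bessel integral, lane log): `G(4e₁) = 0.1217332037`, `G(3e₁+e₂) = 0.1531388988`,
`G(2e₁+2e₂) = 0.1683310356`, `G(2e₁+e₂+e₃) = 0.1917916506` — inside the enclosures.  The widths (`≤ 2.8·10⁻⁷`) are three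
orders of magnitude finer than what the `(2̃,2)` certificate needs (`|∂μ/∂G(x)| ≤ 0.005` at these sites, target precision
`10⁻⁶` in `μ`); a fifth atom `Σ qₙ/(2n−3)` with its own potentials would bring them to the `10⁻⁹` of the first shell.
AS PRINTED: HSS93 tabulate `C₀(0,x)` for `d = 3` only for `|x|₁ ≤ 3` (App. A Table 4 p. 30); the values here are new data of
the same kind, produced by the method of App. A/B (exact heads + asymptotic tails) in certified form.

Kernel cost: one `decide +kernel` evaluation of `GreenNbhd.partialQAt 3 255 [4, 0, 0]` (as the six heads of
`SAWLoopErasureGreenThreeHeads`); everything else is `linarith`/`field_simp`.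

References: [HSS93] T. Hara, G. Slade, A. D. Sokal, J. Stat. Phys. 72 (1993) 479–517, arXiv:hep-lat/9302003, §2.4
(2.36)–(2.39) pp. 10–11, §3.2 (3.13) p. 18, App. A.1 pp. 27–30 (Table 4), App. B p. 32.
-/

noncomputable section

namespace Literature.Probability.RandomPlanarGeometry.SAW.Zd.LoopErasure

namespace GreenThree

open Finset
open Literature.Barriers.CriticalPhenomena.LongRangePhi4 (srwLaw srwLaw_nonneg srwLaw_zero_apply srwLaw_succ_apply)
open Literature.Probability.FitznerVanDerHofstad2017 (SgnPermPair spAct spAct_apply srwI srwI_spAct srwI_one_eq_sum_add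
  hasSum_srwLaw_srwI_one)
open GreenNbhd (partialQAt coordD_of_fin)

/-! ### §1 The class law at `4e₁` -/

/-- **Parts along `e₁`** (`t = 3`): `(m+1)(p_m(2e₁) − p_m(4e₁)) = 18 p_{m+1}(3e₁)`.
[cite: HaraSladeSokal1993, Appendix A.1 pp. 28–30 (relations among the values C₀(0,x) at neighbouring sites); folklore] -/
theorem srwLaw_three_parts_e1'' (m : ℕ) :
    ((m + 1 : ℕ) : ℝ) * (srwLaw 3 m ![2, 0, 0] - srwLaw 3 m ![4, 0, 0]) = 18 * srwLaw 3 (m + 1) ![3, 0, 0] := by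
  have h := srwLaw_parts (d := 2) m 3 ![0, 0, 2] ![0, 0, 4] ![0, 0, 3] (by decide) (by decide) (by decide) (by decide)
    (by decide)
  rw [(srwLaw_three_swaps m 2 0).1, (srwLaw_three_swaps m 4 0).1, (srwLaw_three_swaps (m + 1) 3 0).1] at h
  push_cast at h ⊢
  linarith

/-- **`p_{2n}(4e₁) = p_{2n}(2e₁) − 18 p_{2n+1}(3e₁)/(2n+1)`**.
[cite: HaraSladeSokal1993, Appendix A.1 Table 4 (the values C₀(0,x), d = 3); lane certificate] -/
theorem srwLaw_three_class_4 (n : ℕ) : srwLaw 3 (2 * n) ![4, 0, 0] =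
    srwLaw 3 (2 * n) ![2, 0, 0] - 18 * srwLaw 3 (2 * n + 1) ![3, 0, 0] / (2 * n + 1) := by
  have h := srwLaw_three_parts_e1'' (2 * n)
  push_cast at h
  have hn : (0 : ℝ) < 2 * n + 1 := by positivity
  field_simp
  linarith

/-! ### §2 Three more atoms: `C₂₅₇` (two-sided), `A₂₅₈` (upper), `q₂₅₈ ≤ ρ(258)·q₂₅₇` -/

/-- `C₂₅₇ ≤ θ⁺_inv(257)·q₂₅₇`, `θ⁺_inv(257) = 1757203/2641960`.
[cite: HaraSladeSokal1993, Appendix B p. 32 (Green functions at the neighbours of the origin); lane certificate] -/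
theorem cubicTail_inv_257_le :
    ∑' j, 1 / ((257 + 1 + j : ℕ) : ℝ) * srwLaw 3 (2 * (257 + 1 + j)) 0 ≤ (1757203 / 2641960 : ℝ) * srwLaw 3 (2 * 257) 0 := by
  have h := tsum_cubicTail_inv_le 257 (by norm_num)
  have hθ : thetaInvUp ((257 : ℕ) : ℝ) = 1757203 / 2641960 := by norm_num [thetaInvUp]
  rw [hθ] at h
  exact h

/-- `θ⁻_inv(257)·q₂₅₇ ≤ C₂₅₇`, `θ⁻_inv(257) = 658951/990735`.
[cite: HaraSladeSokal1993, Appendix B p. 32 (Green functions at the neighbours of the origin); lane certificate] -/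
theorem le_cubicTail_inv_257 :
    (658951 / 990735 : ℝ) * srwLaw 3 (2 * 257) 0 ≤ ∑' j, 1 / ((257 + 1 + j : ℕ) : ℝ) * srwLaw 3 (2 * (257 + 1 + j)) 0 := by
  have h := le_tsum_cubicTail_inv 257 (by norm_num)
  have hθ : thetaInvLo ((257 : ℕ) : ℝ) = 658951 / 990735 := by norm_num [thetaInvLo]
  rw [hθ] at h
  exact h

/-- `A₂₅₈ ≤ θ⁺₁(258)·q₂₅₈`, `θ⁺₁(258) = 686941253/1331280`.
[cite: HaraSladeSokal1993, Appendix A.1 pp. 28–30 (tail of C₀(0,0;1/2d)); lane certificate] -/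
theorem cubicTail_one_258_le :
    ∑' j, srwLaw 3 (2 * (258 + 1 + j)) 0 ≤ (686941253 / 1331280 : ℝ) * srwLaw 3 (2 * 258) 0 := by
  have h := tsum_cubicTail_one_le 258 (by norm_num)
  have hθ : thetaOneUp ((258 : ℕ) : ℝ) = 686941253 / 1331280 := by norm_num [thetaOneUp]
  rw [hθ] at h
  exact h

/-- `q₂₅₈ ≤ ρ(258)·q₂₅₇`, `ρ(258) = 91060583/91592064` (`Watson.srwLaw_three_succ_le`).
[cite: HaraSladeSokal1993, Appendix A.1 pp. 28–30 (tail of C₀(0,0;1/2d)); lane certificate] -/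
theorem srwLaw_three_516_le : srwLaw 3 (2 * 258) 0 ≤ (91060583 / 91592064 : ℝ) * srwLaw 3 (2 * 257) 0 := by
  have h := Watson.srwLaw_three_succ_le 257 (by norm_num)
  have hρ : Watson.cubicReturnRatio ((257 : ℕ) + 1 : ℝ) = 91060583 / 91592064 := by norm_num [Watson.cubicReturnRatio]
  rw [show 2 * 258 = 2 * (257 + 1) by norm_num]
  rw [hρ] at h
  exact h

/-! ### §3 The class tail at `4e₁` -/

/-- The class-`4e₁` remainder weight `w(n) = 648/((2n−3)(n−1)(2n−1))` beyond `n = 259`: `0 ≤ w(n) ≤ w(259) = 108/11448965 ≤ 1`.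
[cite: HaraSladeSokal1993, Appendix B p. 32 (Green functions at the neighbours of the origin); lane certificate] -/
theorem shellFour_weight_bounds (n : ℕ) (hn : 259 ≤ n) :
    0 ≤ 648 / ((2 * (n : ℝ) - 3) * ((n : ℝ) - 1) * (2 * (n : ℝ) - 1)) ∧
      648 / ((2 * (n : ℝ) - 3) * ((n : ℝ) - 1) * (2 * (n : ℝ) - 1)) ≤ 108 / 11448965 ∧
      648 / ((2 * (n : ℝ) - 3) * ((n : ℝ) - 1) * (2 * (n : ℝ) - 1)) ≤ 1 := by
  have hn' : (259 : ℝ) ≤ n := by exact_mod_cast hn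
  have hA : (515 : ℝ) ≤ 2 * (n : ℝ) - 3 := by linarith
  have hB : (258 : ℝ) ≤ (n : ℝ) - 1 := by linarith
  have hC : (517 : ℝ) ≤ 2 * (n : ℝ) - 1 := by linarith
  have hAB : (515 * 258 : ℝ) ≤ (2 * (n : ℝ) - 3) * ((n : ℝ) - 1) := by nlinarith
  have hP : (515 * 258 * 517 : ℝ) ≤ (2 * (n : ℝ) - 3) * ((n : ℝ) - 1) * (2 * (n : ℝ) - 1) := by nlinarith
  have hP0 : (0 : ℝ) < (2 * (n : ℝ) - 3) * ((n : ℝ) - 1) * (2 * (n : ℝ) - 1) := by linarith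
  refine ⟨div_nonneg (by norm_num) hP0.le, ?_, ?_⟩
  · rw [div_le_iff₀ hP0]
    linarith
  · rw [div_le_one hP0]
    linarith

/-- The class-`4e₁` remainder `R = Σ_j w(259+j)·q_{259+j}`, `w(n) = 648/((2n−3)(n−1)(2n−1))`, is summable.
[cite: HaraSladeSokal1993, Appendix B p. 32 (Green functions at the neighbours of the origin); lane certificate] -/
theorem summable_shellFour_remainder :
    Summable fun j : ℕ => 648 / ((2 * ((258 + 1 + j : ℕ) : ℝ) - 3) * (((258 + 1 + j : ℕ) : ℝ) - 1) *
      (2 * ((258 + 1 + j : ℕ) : ℝ) - 1)) * srwLaw 3 (2 * (258 + 1 + j)) 0 :=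
  summable_cubicTail_weighted (w := fun n : ℕ => 648 / ((2 * (n : ℝ) - 3) * ((n : ℝ) - 1) * (2 * (n : ℝ) - 1))) 258
    (fun n hn => (shellFour_weight_bounds n (by omega)).1) (fun n hn => (shellFour_weight_bounds n (by omega)).2.2)

/-- `0 ≤ R`. [cite: HaraSladeSokal1993, Appendix B p. 32 (Green functions at the neighbours of the origin); lane certificate] -/
theorem shellFour_remainder_nonneg :
    0 ≤ ∑' j : ℕ, 648 / ((2 * ((258 + 1 + j : ℕ) : ℝ) - 3) * (((258 + 1 + j : ℕ) : ℝ) - 1) *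
      (2 * ((258 + 1 + j : ℕ) : ℝ) - 1)) * srwLaw 3 (2 * (258 + 1 + j)) 0 :=
  tsum_nonneg fun j => mul_nonneg (shellFour_weight_bounds (258 + 1 + j) (by omega)).1 (srwLaw_nonneg _ _)

/-- `R ≤ w(259)·A₂₅₈` (`w` is decreasing: `w(n) ≤ w(259) = 108/11448965` for `n ≥ 259`).
[cite: HaraSladeSokal1993, Appendix B p. 32 (Green functions at the neighbours of the origin); lane certificate] -/
theorem shellFour_remainder_le :
    ∑' j : ℕ, 648 / ((2 * ((258 + 1 + j : ℕ) : ℝ) - 3) * (((258 + 1 + j : ℕ) : ℝ) - 1) *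
      (2 * ((258 + 1 + j : ℕ) : ℝ) - 1)) * srwLaw 3 (2 * (258 + 1 + j)) 0 ≤
      (108 / 11448965 : ℝ) * ∑' j, srwLaw 3 (2 * (258 + 1 + j)) 0 := by
  rw [← tsum_mul_left]
  exact Summable.tsum_le_tsum
    (fun j => mul_le_mul_of_nonneg_right (shellFour_weight_bounds (258 + 1 + j) (by omega)).2.1 (srwLaw_nonneg _ _))
    summable_shellFour_remainder ((summable_cubicTail_one 258).mul_left _)

/-- **Class tail at `4e₁`**: `Σ_k p_{2(255+k)+4}(4e₁) = A₂₅₆ + 192·B₂₅₇ − 108·C₂₅₇ − R`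
(`p_{2n}(4e₁) = qₙ − 24q_{n+1}/(2n+1) + 108q_{n+1}/((2n+1)(n+1)) − 648q_{n+2}/((2n+1)(n+1)(2n+3))`,
`108/((2m−1)m) = 216/(2m−1) − 108/m`).
[cite: HaraSladeSokal1993, Appendix B p. 32 (Green functions at the neighbours of the origin); lane certificate] -/
theorem tsum_classTail_three_4 :
    ∑' k, srwLaw 3 (2 * (255 + k) + 4) ![4, 0, 0] =
      ∑' j, srwLaw 3 (2 * (256 + 1 + j)) 0 +
        192 * ∑' j, 1 / (2 * ((257 + 1 + j : ℕ) : ℝ) - 1) * srwLaw 3 (2 * (257 + 1 + j)) 0 -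
        108 * ∑' j, 1 / ((257 + 1 + j : ℕ) : ℝ) * srwLaw 3 (2 * (257 + 1 + j)) 0 -
        ∑' j : ℕ, 648 / ((2 * ((258 + 1 + j : ℕ) : ℝ) - 3) * (((258 + 1 + j : ℕ) : ℝ) - 1) *
          (2 * ((258 + 1 + j : ℕ) : ℝ) - 1)) * srwLaw 3 (2 * (258 + 1 + j)) 0 := by
  have h := (((summable_cubicTail_one 256).hasSum.add ((summable_cubicTail_odd 257).hasSum.mul_left 192)).sub
    ((summable_cubicTail_inv 257).hasSum.mul_left 108)).sub summable_shellFour_remainder.hasSum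
  refine (h.congr_fun fun k => ?_).tsum_eq
  rw [show 2 * (255 + k) + 4 = 2 * (257 + k) by ring, srwLaw_three_class_4, srwLaw_three_class_3, srwLaw_three_class_2,
    srwLaw_three_class_2, show 256 + 1 + k = 257 + k by ring, show 257 + 1 + k = 257 + k + 1 by ring,
    show 258 + 1 + k = 257 + k + 1 + 1 by ring]
  have hk : (0 : ℝ) ≤ k := Nat.cast_nonneg k
  have h1 : (2 * ((257 + k : ℕ) : ℝ) + 1) ≠ 0 := by positivity
  have h2 : (((257 + k : ℕ) : ℝ) + 1) ≠ 0 := by positivity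
  have h3 : (2 * ((257 + k + 1 : ℕ) : ℝ) + 1) ≠ 0 := by positivity
  have h4 : (2 * ((257 + k + 1 : ℕ) : ℝ) - 1) ≠ 0 := ne_of_gt (by push_cast; linarith)
  have h5 : (((257 + k + 1 : ℕ) : ℝ)) ≠ 0 := by positivity
  have h6 : (2 * ((257 + k + 1 + 1 : ℕ) : ℝ) - 3) ≠ 0 := ne_of_gt (by push_cast; linarith)
  have h7 : (((257 + k + 1 + 1 : ℕ) : ℝ) - 1) ≠ 0 := ne_of_gt (by push_cast; linarith)
  have h8 : (2 * ((257 + k + 1 + 1 : ℕ) : ℝ) - 1) ≠ 0 := ne_of_gt (by push_cast; linarith)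
  field_simp
  push_cast
  ring

/-! ### §4 The head at `4e₁` (`K = 255`) -/

/-- `d = 3`, class `4e₁`: `9306163014649·10⁻¹⁴ ≤ Σ_{k<255} p_{2k+4}(4e₁) ≤ 9306163014650·10⁻¹⁴`
(kernel evaluation of `GreenNbhd.partialQAt 3 255 [4, 0, 0]`).
[cite: HaraSladeSokal1993, Appendix B p. 32 (Green functions at the origin and its neighbours); lane certificate] -/
theorem partialQAt_three_255_4 : (9306163014649 : ℚ) / 10 ^ 14 ≤ partialQAt 3 255 [4, 0, 0] ∧
    partialQAt 3 255 [4, 0, 0] ≤ 9306163014650 / 10 ^ 14 := by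
  decide +kernel

/-! ### §5 The enclosure of `G₃(4e₁)` -/

/-- **`G₃(4e₁) ∈ [0.1217329686, 0.1217332440]`** (`I_{1,0}` at the representative `![4, 0, 0]`; width `2.8·10⁻⁷`, of which
`2.7·10⁻⁷` is the crude enclosure of the remainder `R`).
[cite: HaraSladeSokal1993, Appendix A.1 pp. 27–30 (C₀(0,x;1/2d) by exact heads and asymptotic tails, d = 3); lane certificate] -/
theorem green_three_4 : (1217329686 / 10 ^ 10 : ℝ) ≤ srwI 3 1 0 (![4, 0, 0] : Fin 3 → ℤ) ∧
    srwI 3 1 0 (![4, 0, 0] : Fin 3 → ℤ) ≤ 1217332440 / 10 ^ 10 := by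
  have hdec := srwI_one_eq_partialQAt_add_tsum (d := 3) (x := ![4, 0, 0]) (cs := [4, 0, 0]) (by norm_num)
    (coordD_of_fin rfl (by decide)) rfl 255
  have hs : ([4, 0, 0] : List ℕ).sum = 4 := rfl
  rw [hs, tsum_classTail_three_4] at hdec
  have hlo := (Rat.cast_le (K := ℝ)).2 partialQAt_three_255_4.1
  have hhi := (Rat.cast_le (K := ℝ)).2 partialQAt_three_255_4.2
  push_cast at hlo hhi
  have h5l := srwLaw_three_510_ge
  have h5u := Watson.srwLaw_three_510_le
  have h6l := le_srwLaw_three_512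
  have h6u := srwLaw_three_512_le
  have h7l := le_srwLaw_three_514
  have h7u := srwLaw_three_514_le
  have h8u := srwLaw_three_516_le
  have hAl := le_cubicTail_one_256
  have hAu := cubicTail_one_256_le
  have hBl := le_cubicTail_odd_257
  have hBu := cubicTail_odd_257_le
  have hCl := le_cubicTail_inv_257
  have hCu := cubicTail_inv_257_le
  have hDu := cubicTail_one_258_le
  have hRl := shellFour_remainder_nonneg
  have hRu := shellFour_remainder_le
  have hq8 : 0 ≤ srwLaw 3 (2 * 258) 0 := srwLaw_nonneg _ _
  have hA8 : 0 ≤ ∑' j, srwLaw 3 (2 * (258 + 1 + j)) 0 := tsum_nonneg fun j => srwLaw_nonneg _ _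
  constructor <;> nlinarith

/-! ### §6 Harmonicity and the three remaining classes of the shell `|x|₁ = 4` -/

/-- **Harmonicity of the Green function off the origin** (`d = 3`): `6·G(x) = Σ_j (G(x+e_j) + G(x−e_j))` for `x ≠ 0` — the
one-step recursion `p_{n+1}(x) = (1/6)Σ_{|e|=1} pₙ(x+e)` summed over `n`, with `p₀(x) = 0`.
[cite: HaraSladeSokal1993, Appendix A.1 p. 27 (C₀ is the lattice Green function: (1 − D̂)C₀ = δ); folklore] -/
theorem six_mul_srwI_one_eq_sum (x : Fin 3 → ℤ) (hx : x ≠ 0) :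
    6 * srwI 3 1 0 x = ∑ j : Fin 3, (srwI 3 1 0 (x + Pi.single j 1) + srwI 3 1 0 (x - Pi.single j 1)) := by
  have h1 := hasSum_srwLaw_srwI_one (d := 3) le_rfl 1 x
  have hsplit := srwI_one_eq_sum_add (d := 3) le_rfl 0 1 x
  simp only [Finset.range_one, Finset.sum_singleton, srwLaw_zero_apply, if_neg hx, zero_add] at hsplit
  have hnb : HasSum (fun i : ℕ => ∑ j : Fin 3, (srwLaw 3 i (x + Pi.single j 1) + srwLaw 3 i (x - Pi.single j 1)))
      (∑ j : Fin 3, (srwI 3 1 0 (x + Pi.single j 1) + srwI 3 1 0 (x - Pi.single j 1))) := by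
    refine hasSum_sum fun j _ => ?_
    have ha := hasSum_srwLaw_srwI_one (d := 3) le_rfl 0 (x + Pi.single j 1)
    have hb := hasSum_srwLaw_srwI_one (d := 3) le_rfl 0 (x - Pi.single j 1)
    simp only [Nat.zero_add] at ha hb
    exact ha.add hb
  have h1' : HasSum (fun i : ℕ => (∑ j : Fin 3, (srwLaw 3 i (x + Pi.single j 1) + srwLaw 3 i (x - Pi.single j 1))) / 6)
      (srwI 3 1 1 x) := by
    refine h1.congr_fun fun i => ?_
    rw [Nat.add_comm, srwLaw_succ_apply]
    norm_num
  have huniq := h1'.unique (hnb.div_const 6)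
  rw [hsplit, huniq]
  ring

/-- Transport of `G` along a signed permutation, concrete form: `u = spAct τ x ⇒ G(u) = G(x)` (the tree's `srwI_spAct`).
[cite: HaraSladeSokal1993, Appendix A.1 p. 27 (the lattice symmetries used to group the sites x of C₀(0,x)); folklore] -/
theorem srwI_one_eq_of_spAct (τ : SgnPermPair 3) (x u : Fin 3 → ℤ) (hu : u = spAct τ x) :
    srwI 3 1 0 u = srwI 3 1 0 x := by
  rw [hu]
  exact srwI_spAct 1 0 τ x

/-- The six neighbours of a site of `ℤ³` written with numerals: `Σ_j (f(x+e_j) + f(x−e_j))` for `x = (a,b,c)`.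
[cite: HaraSladeSokal1993, Appendix A.1 p. 27 (the lattice symmetries used to group the sites x of C₀(0,x)); lane plumbing] -/
theorem sum_nbrs_three (f : (Fin 3 → ℤ) → ℝ) (a b c : ℤ) :
    ∑ j : Fin 3, (f (![a, b, c] + Pi.single j 1) + f (![a, b, c] - Pi.single j 1)) =
      f ![a + 1, b, c] + f ![a - 1, b, c] + (f ![a, b + 1, c] + f ![a, b - 1, c]) + (f ![a, b, c + 1] + f ![a, b, c - 1]) := by
  have e1 : (![a, b, c] : Fin 3 → ℤ) + Pi.single 0 1 = ![a + 1, b, c] := by funext i; fin_cases i <;> simp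
  have e2 : (![a, b, c] : Fin 3 → ℤ) - Pi.single 0 1 = ![a - 1, b, c] := by funext i; fin_cases i <;> simp
  have e3 : (![a, b, c] : Fin 3 → ℤ) + Pi.single 1 1 = ![a, b + 1, c] := by funext i; fin_cases i <;> simp
  have e4 : (![a, b, c] : Fin 3 → ℤ) - Pi.single 1 1 = ![a, b - 1, c] := by funext i; fin_cases i <;> simp
  have e5 : (![a, b, c] : Fin 3 → ℤ) + Pi.single 2 1 = ![a, b, c + 1] := by funext i; fin_cases i <;> simp
  have e6 : (![a, b, c] : Fin 3 → ℤ) - Pi.single 2 1 = ![a, b, c - 1] := by funext i; fin_cases i <;> simp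
  rw [Fin.sum_univ_three, e1, e2, e3, e4, e5, e6]

/-- **Harmonicity at `3e₁`**: `6·G(3e₁) = G(2e₁) + G(4e₁) + 4·G(3e₁+e₂)`.
[cite: HaraSladeSokal1993, Appendix A.1 p. 27 (C₀ is the lattice Green function; lattice symmetries); folklore] -/
theorem green_three_harmonic_3 : 6 * srwI 3 1 0 (![3, 0, 0] : Fin 3 → ℤ) =
    srwI 3 1 0 (![2, 0, 0] : Fin 3 → ℤ) + srwI 3 1 0 (![4, 0, 0] : Fin 3 → ℤ) + 4 * srwI 3 1 0 (![3, 1, 0] : Fin 3 → ℤ) := by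
  have h := six_mul_srwI_one_eq_sum ![3, 0, 0] (by
    intro h0
    have := congrFun h0 0
    simp at this)
  rw [sum_nbrs_three] at h
  have s1 : srwI 3 1 0 (![3, 0 - 1, 0] : Fin 3 → ℤ) = srwI 3 1 0 ![3, 1, 0] :=
    srwI_one_eq_of_spAct (1, fun i => if i = 1 then -1 else 1) _ _ (by funext i; fin_cases i <;> simp [spAct_apply])
  have s2 : srwI 3 1 0 (![3, 0, 0 + 1] : Fin 3 → ℤ) = srwI 3 1 0 ![3, 1, 0] :=
    srwI_one_eq_of_spAct (Equiv.swap 1 2, fun _ => 1) _ _ (by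
      funext i; fin_cases i <;> simp [spAct_apply, Equiv.swap_apply_def])
  have s3 : srwI 3 1 0 (![3, 0, 0 - 1] : Fin 3 → ℤ) = srwI 3 1 0 ![3, 1, 0] :=
    srwI_one_eq_of_spAct (Equiv.swap 1 2, fun i => if i = 2 then -1 else 1) _ _ (by
      funext i; fin_cases i <;> simp [spAct_apply, Equiv.swap_apply_def])
  have s4 : (![3 + 1, 0, 0] : Fin 3 → ℤ) = ![4, 0, 0] := by norm_num
  have s5 : (![3 - 1, 0, 0] : Fin 3 → ℤ) = ![2, 0, 0] := by norm_num
  have s6 : (![3, 0 + 1, 0] : Fin 3 → ℤ) = ![3, 1, 0] := by norm_num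
  rw [s1, s2, s3, s4, s5, s6] at h
  linarith

/-- **Harmonicity at `2e₁+e₂`**: `6·G(2e₁+e₂) = G(3e₁+e₂) + G(e₁+e₂) + G(2e₁+2e₂) + G(2e₁) + 2·G(2e₁+e₂+e₃)`.
[cite: HaraSladeSokal1993, Appendix A.1 p. 27 (C₀ is the lattice Green function; lattice symmetries); folklore] -/
theorem green_three_harmonic_21 : 6 * srwI 3 1 0 (![2, 1, 0] : Fin 3 → ℤ) =
    srwI 3 1 0 (![3, 1, 0] : Fin 3 → ℤ) + srwI 3 1 0 (![1, 1, 0] : Fin 3 → ℤ) + srwI 3 1 0 (![2, 2, 0] : Fin 3 → ℤ) +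
      srwI 3 1 0 (![2, 0, 0] : Fin 3 → ℤ) + 2 * srwI 3 1 0 (![2, 1, 1] : Fin 3 → ℤ) := by
  have h := six_mul_srwI_one_eq_sum ![2, 1, 0] (by
    intro h0
    have := congrFun h0 0
    simp at this)
  rw [sum_nbrs_three] at h
  have s1 : srwI 3 1 0 (![2, 1, 0 - 1] : Fin 3 → ℤ) = srwI 3 1 0 ![2, 1, 1] :=
    srwI_one_eq_of_spAct (1, fun i => if i = 2 then -1 else 1) _ _ (by funext i; fin_cases i <;> simp [spAct_apply])
  have s2 : (![2 + 1, 1, 0] : Fin 3 → ℤ) = ![3, 1, 0] := by norm_num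
  have s3 : (![2 - 1, 1, 0] : Fin 3 → ℤ) = ![1, 1, 0] := by norm_num
  have s4 : (![2, 1 + 1, 0] : Fin 3 → ℤ) = ![2, 2, 0] := by norm_num
  have s5 : (![2, 1 - 1, 0] : Fin 3 → ℤ) = ![2, 0, 0] := by norm_num
  have s6 : (![2, 1, 0 + 1] : Fin 3 → ℤ) = ![2, 1, 1] := by norm_num
  rw [s1, s2, s3, s4, s5, s6] at h
  linarith

/-- **Harmonicity at `e₁+e₂+e₃`**: `6·G(e₁+e₂+e₃) = 3·G(e₁+e₂) + 3·G(2e₁+e₂+e₃)`.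
[cite: HaraSladeSokal1993, Appendix A.1 p. 27 (C₀ is the lattice Green function; lattice symmetries); folklore] -/
theorem green_three_harmonic_111 : 6 * srwI 3 1 0 (![1, 1, 1] : Fin 3 → ℤ) =
    3 * srwI 3 1 0 (![1, 1, 0] : Fin 3 → ℤ) + 3 * srwI 3 1 0 (![2, 1, 1] : Fin 3 → ℤ) := by
  have h := six_mul_srwI_one_eq_sum ![1, 1, 1] (by
    intro h0
    have := congrFun h0 0
    simp at this)
  rw [sum_nbrs_three] at h
  have s1 : srwI 3 1 0 (![1 - 1, 1, 1] : Fin 3 → ℤ) = srwI 3 1 0 ![1, 1, 0] :=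
    srwI_one_eq_of_spAct (Equiv.swap 0 2, fun _ => 1) _ _ (by
      funext i; fin_cases i <;> simp [spAct_apply, Equiv.swap_apply_def])
  have s2 : srwI 3 1 0 (![1, 1 + 1, 1] : Fin 3 → ℤ) = srwI 3 1 0 ![2, 1, 1] :=
    srwI_one_eq_of_spAct (Equiv.swap 0 1, fun _ => 1) _ _ (by
      funext i; fin_cases i <;> simp [spAct_apply, Equiv.swap_apply_def])
  have s3 : srwI 3 1 0 (![1, 1 - 1, 1] : Fin 3 → ℤ) = srwI 3 1 0 ![1, 1, 0] :=
    srwI_one_eq_of_spAct (Equiv.swap 1 2, fun _ => 1) _ _ (by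
      funext i; fin_cases i <;> simp [spAct_apply, Equiv.swap_apply_def])
  have s4 : srwI 3 1 0 (![1, 1, 1 + 1] : Fin 3 → ℤ) = srwI 3 1 0 ![2, 1, 1] :=
    srwI_one_eq_of_spAct (Equiv.swap 0 2, fun _ => 1) _ _ (by
      funext i; fin_cases i <;> simp [spAct_apply, Equiv.swap_apply_def])
  have s5 : (![1 + 1, 1, 1] : Fin 3 → ℤ) = ![2, 1, 1] := by norm_num
  have s6 : (![1, 1, 1 - 1] : Fin 3 → ℤ) = ![1, 1, 0] := by norm_num
  rw [s1, s2, s3, s4, s5, s6] at h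
  linarith

/-- **`G₃(2e₁+e₂+e₃) ∈ [0.1917916504, 0.1917916509]`** (`= 2G(e₁+e₂+e₃) − G(e₁+e₂)`, representative `![2, 1, 1]`).
[cite: HaraSladeSokal1993, Appendix A.1 pp. 27–30 (C₀(0,x;1/2d), d = 3); lane certificate] -/
theorem green_three_211 : (1917916504 / 10 ^ 10 : ℝ) ≤ srwI 3 1 0 (![2, 1, 1] : Fin 3 → ℤ) ∧
    srwI 3 1 0 (![2, 1, 1] : Fin 3 → ℤ) ≤ 1917916509 / 10 ^ 10 := by
  have h := green_three_harmonic_111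
  obtain ⟨a, b⟩ := green_three_11
  obtain ⟨c, e⟩ := green_three_111
  constructor <;> linarith

/-- **`G₃(3e₁+e₂) ∈ [0.1531388882, 0.1531389581]`** (`= (6G(3e₁) − G(2e₁) − G(4e₁))/4`, representative `![3, 1, 0]`).
[cite: HaraSladeSokal1993, Appendix A.1 pp. 27–30 (C₀(0,x;1/2d), d = 3); lane certificate] -/
theorem green_three_31 : (1531388882 / 10 ^ 10 : ℝ) ≤ srwI 3 1 0 (![3, 1, 0] : Fin 3 → ℤ) ∧
    srwI 3 1 0 (![3, 1, 0] : Fin 3 → ℤ) ≤ 1531389581 / 10 ^ 10 := by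
  have h := green_three_harmonic_3
  obtain ⟨a, b⟩ := green_three_3
  obtain ⟨c, e⟩ := green_three_2
  obtain ⟨f, g⟩ := green_three_4
  constructor <;> linarith

/-- **`G₃(2e₁+2e₂) ∈ [0.1683309753, 0.1683310474]`** (`= 6G(2e₁+e₂) − G(e₁+e₂) − G(3e₁+e₂) − G(2e₁) − 2G(2e₁+e₂+e₃)`,
representative `![2, 2, 0]`). [cite: HaraSladeSokal1993, Appendix A.1 pp. 27–30 (C₀(0,x;1/2d), d = 3); lane certificate] -/
theorem green_three_22 : (1683309753 / 10 ^ 10 : ℝ) ≤ srwI 3 1 0 (![2, 2, 0] : Fin 3 → ℤ) ∧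
    srwI 3 1 0 (![2, 2, 0] : Fin 3 → ℤ) ≤ 1683310474 / 10 ^ 10 := by
  have h := green_three_harmonic_21
  obtain ⟨a, b⟩ := green_three_21
  obtain ⟨c, e⟩ := green_three_11
  obtain ⟨f, g⟩ := green_three_31
  obtain ⟨i, j⟩ := green_three_2
  obtain ⟨k, l⟩ := green_three_211
  constructor <;> linarith

end GreenThree

end Literature.Probability.RandomPlanarGeometry.SAW.Zd.LoopErasure
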